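import Summits.BirchSwinnertonDyer.BirchSwinnertonDyer.Theses.ThetaPartnerAtTwo
import Summits.BirchSwinnertonDyer.BirchSwinnertonDyer.Theorems.ThetaPartnerAtTwoSignedKatoUpToAtTwoIwasawaInvolutionCompat
import HarnessLib

/-!
# Route `ThetaPartnerAtTwo` (TP2), crux K3 `SignedKatoDivisibilityUpToAtTwo` (item stmt-BirchSwinnertonDyer-20308) —
# K3 AS FILED (tree `γ`-convention dual `D : SignedSelmerDualData W κ γ 1`) IS EQUIVALENT TO ITS PRINT-CONVENTION TWIN
# (contragredient dual `D : SignedSelmerDualData W κ γ⁻¹ 1`), by the in-tree functional equation of `L♭` at `2`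

Width seat `bsd-wall-tp2-p2x-w3` g3 (cell `bsd-wall`). HONEST FRAMING: THEOREMS ONLY — no definition, no named fact, no
instance, no `sorry`; K3 is NOT proved here (both sides are hypotheses of the equivalence); closes no item; BSD is NOT proved by
any of this.

## Why this file

The convention audit (`Cruxes/SignedKatoDivisibilityUpToAtTwo/G4-CONVENTION-AUDIT.md` §1, second reader
`W3G2-READER-G4-AUDIT.md`) observed that the crux K3 quantifies over the tree's dual data `SignedSelmerDualData W κ γ 1`, whose
`Λ`-action (`(T·x)(s) = x(conj_γ s) − x(s)`) is the `ι`-twist of print's contragredient `X⁺(E/ℚ_∞)`; so «K3 = print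
divisibility for `L♭^ι`», which is «fine but silently FE-dependent». This file makes that remark a KERNEL THEOREM: with the
functional equation `ι L♭ = u · L♭` (`u ∈ Λˣ`) — IN TREE for every Pollack pair at `2` on the habitat
(`SignedKatoOffTwo.Invol.exists_isUnit_invol_kobayashiL_one_eq_mul`, from
`Literature.Barriers.BirchSwinnertonDyer.exists_functionalEquation_sharp_flat_two`) — the crux
`Theses.ThetaPartnerAtTwo.SignedKatoDivisibilityUpToAtTwo` is EQUIVALENT to the same text over the contragredient data
`D : SignedSelmerDualData W κ γ⁻¹ 1` (`signedKatoDivisibilityUpToAtTwo_iff_contragredient`). Consequently NO RETYPING of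
item 20308 is needed on account of the convention audit; only the intermediate statements (K2, R2) carry the `ι`
(handled by `…KatoBoundTwist`, skeleton `colemanrat` v5).

## What is proved

* `k3Conclusion_of_twist` — the (R2′)→K3 bridge with the power of `2` INSIDE the existential (`∃ g h m`), for either
  direction of the twist (`γδ = 1`): K3's conclusion for all `δ`-data + `ι L = u L` ⟹ K3's conclusion for every `γ`-datum.
* `signedKatoDivisibilityUpToAtTwo_of_contragredient` (print twin ⟹ K3 BY NAME),
  `contragredient_of_signedKatoDivisibilityUpToAtTwo` (K3 ⟹ print twin), `signedKatoDivisibilityUpToAtTwo_iff_contragredient`.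

References: [GreenbergLNM1716, §1 (pp. 60, 67–68)]; [MazurTateTeitelbaum1986Invent, §I.17]; [Kobayashi2003, Def. 1.1];
[Sprung2017, Cor. 4.14]; [Kato2004Asterisque, §17.13].
-/

set_option autoImplicit false
-- the Theorems namespace of this sub repeats the summit name by design (D-0017 nested layout)
set_option linter.dupNamespace false

noncomputable section

open scoped Classical MatrixGroups ModularForm NumberField

namespace Summit.BirchSwinnertonDyer.BirchSwinnertonDyer.Theorems

namespace SignedKatoOffTwo.IwasawaInvolution

open PowerSeries CongruenceSubgroup WeierstrassCurve Field Literature.NumberTheory.EllipticCurves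
  Literature.NumberTheory.EllipticCurves.Module Literature.NumberTheory.EllipticCurves.ModularForms
  Literature.NumberTheory.EllipticCurves.Kobayashi2003 Literature.NumberTheory.EllipticCurves.Rank1Residual
  Literature.Barriers.BirchSwinnertonDyer Summit.BirchSwinnertonDyer.Rank1Residual.Supersingular ZpExtension

/-! ## §1 The bridge with `∃ m` inside -/

/-- **K3's conclusion transfers across the `γ ↦ γ⁻¹` twist under a functional equation** (any prime `p`): if every `δ`-datum
satisfies `∃ g h m, char = (g) ∧ (g h)^ℚ = C(p^m ϖ) · L^ℚ` and `ι L = u L` with `u` a unit, then so does every `γ`-datum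
(`γδ = 1`): `char(D) = (ι g′)` and `ι g′ · (ι h′ · u⁻¹)` works. [cite: GreenbergLNM1716, §1 (functional equation)] -/
theorem k3Conclusion_of_twist {p : ℕ} [Fact p.Prime] {K : Type} [Field K] [NumberField K] {W : WeierstrassCurve K}
    {κ : ZpExtension K p} {γ δ : absoluteGaloisGroup K} {ε : ℤˣ} (hγδ : γ * δ = 1) {L : IwasawaAlgebra p}
    (hFE : ∃ u : IwasawaAlgebra p, IsUnit u ∧ IwasawaAlgebra.invol p L = u * L) (ϖ : ℚ)
    (hD' : ∀ D' : SignedSelmerDualData W κ δ ε, ∃ (g h : IwasawaAlgebra p) (m : ℕ),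
      D'.charIdeal = Ideal.span {g} ∧
        iwasawaToPowerSeries p (g * h) = PowerSeries.C ((p : ℚ_[p]) ^ m * (ϖ : ℚ_[p])) * iwasawaToPowerSeries p L)
    (D : SignedSelmerDualData W κ γ ε) :
    ∃ (g h : IwasawaAlgebra p) (m : ℕ), D.charIdeal = Ideal.span {g} ∧
      iwasawaToPowerSeries p (g * h) = PowerSeries.C ((p : ℚ_[p]) ^ m * (ϖ : ℚ_[p])) * iwasawaToPowerSeries p L := by
  set ι : IwasawaAlgebra p ≃+* IwasawaAlgebra p := (IwasawaAlgebra.involEquiv p : IwasawaAlgebra p ≃+* IwasawaAlgebra p)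
    with hιdef
  have hι : ∀ f : IwasawaAlgebra p, ι f = subst (invOnePlusSubOne : ℤ_[p]⟦X⟧) f := involEquiv_eq_subst p
  obtain ⟨u, hu, hFE⟩ := hFE
  have hιL : ι L = u * L := hFE
  obtain ⟨D', e, he, -, -, hchar, -⟩ := exists_twist_signedSelmerDualData_invariants ι hι hγδ D
  obtain ⟨g', h', m, hg', hgh'⟩ := hD' D'
  refine ⟨ι g', ι h' * ↑(hu.unit⁻¹), m, ?_, ?_⟩
  · have h1 : D.charIdeal = (D'.charIdeal).map ι := by
      rw [hchar, map_invol_eq_comap ι hι, map_invol_eq_comap ι hι, comap_comap_invol ι hι]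
    rw [h1, hg', Ideal.map_span, Set.image_singleton]
  · have key : iwasawaToPowerSeries p (ι g' * ι h') =
        PowerSeries.C ((p : ℚ_[p]) ^ m * (ϖ : ℚ_[p])) * iwasawaToPowerSeries p u * iwasawaToPowerSeries p L := by
      rw [← map_mul ι, iwasawaToPowerSeries_invol ι hι, hgh', subst_mul hasSubst_invOnePlusSubOne,
        ← iwasawaToPowerSeries_invol ι hι, hιL, map_mul (iwasawaToPowerSeries p) u L, ← mul_assoc]
      congr 2
      exact subst_C _
    have hvu : u * ↑(hu.unit⁻¹) = 1 := hu.mul_val_inv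
    calc iwasawaToPowerSeries p (ι g' * (ι h' * ↑(hu.unit⁻¹)))
        = iwasawaToPowerSeries p (ι g' * ι h') * iwasawaToPowerSeries p ↑(hu.unit⁻¹) := by
          rw [← map_mul, mul_assoc]
      _ = PowerSeries.C ((p : ℚ_[p]) ^ m * (ϖ : ℚ_[p])) * iwasawaToPowerSeries p L *
            iwasawaToPowerSeries p (u * ↑(hu.unit⁻¹)) := by
          rw [key, map_mul (iwasawaToPowerSeries p) u]; ring
      _ = PowerSeries.C ((p : ℚ_[p]) ^ m * (ϖ : ℚ_[p])) * iwasawaToPowerSeries p L := by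
          rw [hvu, map_one, mul_one]

/-! ## §2 K3 ⟺ its contragredient twin -/

/-- **The print-convention twin implies K3 BY NAME.** If Kato's divisibility up to a power of `2` holds for the CONTRAGREDIENT
dual data `D : SignedSelmerDualData W κ γ⁻¹ 1` (print's `X⁺(E/ℚ_∞)` with `(γ·x)(s) = x(γ⁻¹ s)`), then the crux
`SignedKatoDivisibilityUpToAtTwo` (tree `γ`-convention data) holds — via the in-tree functional equation of
`L_Ko = kobayashiL 1 L⁺ L⁻` at `2`. [cite: MazurTateTeitelbaum1986Invent, §I.17] [cite: GreenbergLNM1716, §1 (pp. 67–68)] -/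
theorem signedKatoDivisibilityUpToAtTwo_of_contragredient
    (h : ∀ (W : WeierstrassCurve ℚ) [W.IsElliptic] [W.IsGloballyMinimal], ¬ W.HasCM → W.analyticRank = 0 →
      GoodSS W 2 → W.frobeniusTrace 2 = 0 →
      ∀ (κ : ZpExtension ℚ 2) (γ : absoluteGaloisGroup ℚ), κ.IsCyclotomic → κ.IsTopGenerator γ →
        IsCyclotomicVariable 2 γ →
      ∀ [NeZero (W.conductorNorm ℤ)] (f : CuspForm (Gamma0 (W.conductorNorm ℤ)) 2), IsNewformOf W f →
      ∀ (ϖ : ℚ), (ϖ : ℝ) * W.realPeriodRat = plusPeriod f →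
      ∀ (Lplus Lminus : IwasawaAlgebra 2), IsPollackPair f 2 Lplus Lminus →
      ∀ (D : SignedSelmerDualData W κ γ⁻¹ 1), ∃ (g h : IwasawaAlgebra 2) (m : ℕ),
        D.charIdeal = Ideal.span {g} ∧
          iwasawaToPowerSeries 2 (g * h) =
            PowerSeries.C ((2 : ℚ_[2]) ^ m * (ϖ : ℚ_[2])) * iwasawaToPowerSeries 2 (kobayashiL 1 Lplus Lminus)) :
    Theses.ThetaPartnerAtTwo.SignedKatoDivisibilityUpToAtTwo := by
  intro W _ _ hcm hr hss ha κ γ hκ hγ hcv _ f hf ϖ hϖ Lplus Lminus hPP D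
  have hFE := Invol.exists_isUnit_invol_kobayashiL_one_eq_mul hf hss ha hPP
  have h2 : ((2 : ℕ) : ℚ_[2]) = (2 : ℚ_[2]) := by norm_num
  have := k3Conclusion_of_twist (p := 2) (ε := 1) (mul_inv_cancel γ) hFE ϖ
    (fun D' ↦ by simpa only [h2] using h W hcm hr hss ha κ γ hκ hγ hcv f hf ϖ hϖ Lplus Lminus hPP D') D
  simpa only [h2] using this

/-- **K3 implies its print-convention twin** (the converse transfer, twist `γ⁻¹ ↦ γ`). [cite: MazurTateTeitelbaum1986Invent, §I.17]
[cite: GreenbergLNM1716, §1 (pp. 67–68)] -/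
theorem contragredient_of_signedKatoDivisibilityUpToAtTwo (h : Theses.ThetaPartnerAtTwo.SignedKatoDivisibilityUpToAtTwo) :
    ∀ (W : WeierstrassCurve ℚ) [W.IsElliptic] [W.IsGloballyMinimal], ¬ W.HasCM → W.analyticRank = 0 →
      GoodSS W 2 → W.frobeniusTrace 2 = 0 →
      ∀ (κ : ZpExtension ℚ 2) (γ : absoluteGaloisGroup ℚ), κ.IsCyclotomic → κ.IsTopGenerator γ →
        IsCyclotomicVariable 2 γ →
      ∀ [NeZero (W.conductorNorm ℤ)] (f : CuspForm (Gamma0 (W.conductorNorm ℤ)) 2), IsNewformOf W f →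
      ∀ (ϖ : ℚ), (ϖ : ℝ) * W.realPeriodRat = plusPeriod f →
      ∀ (Lplus Lminus : IwasawaAlgebra 2), IsPollackPair f 2 Lplus Lminus →
      ∀ (D : SignedSelmerDualData W κ γ⁻¹ 1), ∃ (g h : IwasawaAlgebra 2) (m : ℕ),
        D.charIdeal = Ideal.span {g} ∧
          iwasawaToPowerSeries 2 (g * h) =
            PowerSeries.C ((2 : ℚ_[2]) ^ m * (ϖ : ℚ_[2])) * iwasawaToPowerSeries 2 (kobayashiL 1 Lplus Lminus) := by
  intro W _ _ hcm hr hss ha κ γ hκ hγ hcv _ f hf ϖ hϖ Lplus Lminus hPP D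
  have hFE := Invol.exists_isUnit_invol_kobayashiL_one_eq_mul hf hss ha hPP
  have h2 : ((2 : ℕ) : ℚ_[2]) = (2 : ℚ_[2]) := by norm_num
  have := k3Conclusion_of_twist (p := 2) (ε := 1) (inv_mul_cancel γ) hFE ϖ
    (fun D' ↦ by simpa only [h2] using h W hcm hr hss ha κ γ hκ hγ hcv f hf ϖ hϖ Lplus Lminus hPP D') D
  simpa only [h2] using this

/-- **K3 ⟺ its print-convention (contragredient) twin.** [cite: MazurTateTeitelbaum1986Invent, §I.17]
[cite: GreenbergLNM1716, §1 (pp. 67–68)] -/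
theorem signedKatoDivisibilityUpToAtTwo_iff_contragredient :
    Theses.ThetaPartnerAtTwo.SignedKatoDivisibilityUpToAtTwo ↔
    ∀ (W : WeierstrassCurve ℚ) [W.IsElliptic] [W.IsGloballyMinimal], ¬ W.HasCM → W.analyticRank = 0 →
      GoodSS W 2 → W.frobeniusTrace 2 = 0 →
      ∀ (κ : ZpExtension ℚ 2) (γ : absoluteGaloisGroup ℚ), κ.IsCyclotomic → κ.IsTopGenerator γ →
        IsCyclotomicVariable 2 γ →
      ∀ [NeZero (W.conductorNorm ℤ)] (f : CuspForm (Gamma0 (W.conductorNorm ℤ)) 2), IsNewformOf W f →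
      ∀ (ϖ : ℚ), (ϖ : ℝ) * W.realPeriodRat = plusPeriod f →
      ∀ (Lplus Lminus : IwasawaAlgebra 2), IsPollackPair f 2 Lplus Lminus →
      ∀ (D : SignedSelmerDualData W κ γ⁻¹ 1), ∃ (g h : IwasawaAlgebra 2) (m : ℕ),
        D.charIdeal = Ideal.span {g} ∧
          iwasawaToPowerSeries 2 (g * h) =
            PowerSeries.C ((2 : ℚ_[2]) ^ m * (ϖ : ℚ_[2])) * iwasawaToPowerSeries 2 (kobayashiL 1 Lplus Lminus) :=
  ⟨contragredient_of_signedKatoDivisibilityUpToAtTwo, signedKatoDivisibilityUpToAtTwo_of_contragredient⟩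

end SignedKatoOffTwo.IwasawaInvolution

end Summit.BirchSwinnertonDyer.BirchSwinnertonDyer.Theorems

end
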